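import Mathlib

/-!
# Federbush–Williamson, *A phase cell approach to Yang–Mills theory. II. Analysis of a mode* (J. Math. Phys. 28 (1987)
# 1416–1419) — the explicit momentum-space mode `A^N_i(p)` ((1.2)–(1.7), (1.18), (2.1)–(2.5)) and THEOREMS 3.1 (local
# analyticity), 3.2 (global analyticity), 3.3 (boundedness), with §IV (⇒ I (3.13)–(3.15)): TYPED STATEMENTS with citation tags

statement-level skeleton of published theorems with citation tags; proofs where landed; nothing here is a claim about the Yang–Mills mass gap

Cell `lit-balaban`, reader/typer block **r17 = Federbush**; SKELETON rows `F2-…` of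
`run/shared/lean/pub/lit-balaban/lit-balaban-r17/SKELETON-r17.md`.

**Source.** P. Federbush, C. Williamson, J. Math. Phys. **28** (1987) 1416–1419 [bib `FederbushWilliamson1987PhaseCellII`;
doi:10.1063/1.527495]; pages READ AS IMAGES: p. 1416 (§I, (1.1)–(1.15)) and p. 1417 ((1.16)–(1.20), §II (2.1)–(2.5), §III
Theorems 3.1–3.3 (3.1)–(3.5), §IV, (5.1)) — Deep-Blue scan `run/shared/lean/pub/pub-balaban/t4/b2b-balaban-t4-lit2/pdf/
fedwill1987-jmp28-II.pdf`, renders `…/b2b-balaban-t4-lit2/g7/fw1987II/fedwill1987-jmp28-II-p001|p002-x2.png`.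

**Why in the corpus.** Part I (CMP 107) p. 328 defers its (3.13)–(3.15) — the decay/regularity of the level-0 mode behind
Estimates 0.1–0.3 — to this paper («We there show»); §IV here: «Equations (3.13)–(3.15) of Ref. 1 follow directly from
Theorems 3.2 and 3.3 of the last section by standard techniques.»  The T⁴ spine's literature seat cites
`[cite: FederbushWilliamson1987PhaseCellII, Thm 3.1 (3.2) p. 1417 (proved §V–§VI); Thms 3.2–3.3 (3.3)–(3.5) p. 1417 (stated as
consequences); §IV p. 1417]` (`t4/T4-LIT2-CITABLE-NE.md` (L-2)).

**What is typed, and how (F6).**  EVERYTHING HERE IS CONCRETE: the printed formulas are explicit functions of the momentum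
`p = (p₁, p₂, p₃, p₄)`, typed on `ℂ⁴ = Fin 4 → ℂ` directly in their §III analytic extension («We take the analytic
extensions of the expressions in Sec. II from real p to complex p. For example, f̄_i → e^{ip_i} − 1 and
|(e^{−ip_i} − 1)/(p_i + 2πn_i)|² → ((e^{−ip_i} − 1)/(p_i + 2πn_i))·((e^{ip_i} − 1)/(p_i + 2πn_i))», p. 1417): the lattice sum
`⟨h(p)⟩` (1.4) as a `tsum` over `n ∈ ℤ⁴`, `r_L` (1.7), `𝒟` (1.18), `l_i` (2.2)–(2.3), `A′_i` (2.1), `X(p)` (2.5), `A^N_i = A′_i +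
p_iX` (2.4).  Print's index «1» (the direction of the non-zero bond) is `0 : Fin 4`.  The formula has removable
singularities (divisions by `p²`, `p_i`, `𝒟`, `f̄₁`, …; Lean's `x/0 = 0` gives junk values there), so «A^N_i(p) is
analytic in the domain 𝒟» is typed as: there is a function analytic at every point of `𝒟` which agrees with the formula at
the real momenta `p ∈ (−π, π]⁴` with all `p_j ≠ 0` (where every denominator is non-zero); by the identity theorem this
determines the extension, so nothing is weakened.  «s is an arbitrary integer, sufficiently large» (after (2.5)) is the
outer quantifier `∃ s₀, ∀ s ≥ s₀`.
-/

namespace Literature.MathematicalPhysics.QuantumFieldTheory.Federbush1986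

noncomputable section

open Complex
open scoped BigOperators

namespace ModeAnalyticity

/-- Complex momenta `p = (p₁, …, p₄)`; print's index `1` is `0 : Fin 4`. [cite: FederbushWilliamson1987PhaseCellII, §I p. 1416] -/
abbrev Momentum := Fin 4 → ℂ

/-- `p² = Σ_j p_j²` (analytic extension of the Euclidean square). [cite: FederbushWilliamson1987PhaseCellII, (1.4) p. 1416,
§III p. 1417] -/
def csq (p : Momentum) : ℂ := ∑ j, p j ^ 2

/-- The shifted momentum `p + 2πn`, `n ∈ ℤ⁴` («n is a four-vector with integer components»).
[cite: FederbushWilliamson1987PhaseCellII, (1.4) p. 1416, (3.1) p. 1417] -/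
def shift (p : Momentum) (n : Fin 4 → ℤ) : Momentum := fun j => p j + 2 * Real.pi * (n j : ℂ)

/-- «f_i ≡ (e^{−ip_i} − 1) (1.2)». [cite: FederbushWilliamson1987PhaseCellII, (1.2) p. 1416] -/
def f (p : Momentum) (i : Fin 4) : ℂ := exp (-I * p i) - 1

/-- The conjugate factor `f̄_i`, in its analytic extension «f̄_i → e^{ip_i} − 1» (§III).
[cite: FederbushWilliamson1987PhaseCellII, (1.5) p. 1416, §III p. 1417] -/
def fbar (p : Momentum) (i : Fin 4) : ℂ := exp (I * p i) - 1

/-- «⟨h(p)⟩ ≡ Σ_n (1/(p + 2πn)²) ∏_{i=1}^4 |(e^{ip_i} − 1)/(p_i + 2πn_i)|² h(p + 2πn), (1.4) where h is any function of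
p = (p₁, p₂, p₃, p₄)», with the modulus squared in its analytic extension (§III).  `tsum` over `ℤ⁴`.
[cite: FederbushWilliamson1987PhaseCellII, (1.4) p. 1416, §III p. 1417] -/
def bracket (h : Momentum → ℂ) (p : Momentum) : ℂ :=
  ∑' n : Fin 4 → ℤ,
    (1 / csq (shift p n)) *
      (∏ i, (exp (-I * p i) - 1) * (exp (I * p i) - 1) / (shift p n i) ^ 2) * h (shift p n)

/-- «r_L ≡ −(i/(2π)²) ∏_k ((e^{−ip_k} − 1)/p_k), (1.7)». [cite: FederbushWilliamson1987PhaseCellII, (1.7) p. 1416] -/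
def rL (p : Momentum) : ℂ := -(I / (2 * Real.pi) ^ 2) * ∏ k, (exp (-I * p k) - 1) / p k

/-- `⟨1/p_j²⟩` (the building block of (1.16)–(1.20), (2.2)–(2.3), (2.5)). [cite: FederbushWilliamson1987PhaseCellII,
(1.17) p. 1417] -/
def invSqBracket (j : Fin 4) (p : Momentum) : ℂ := bracket (fun q => 1 / q j ^ 2) p

/-- «𝒟 = 16 Σ_k ∏_{j≠k} ⟨1/p_j²⟩. (1.18) Here 𝒟 has arisen as the determinant of the 3×3 matrix involved in the computation
of m⁻¹.» [cite: FederbushWilliamson1987PhaseCellII, (1.18) p. 1417] -/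
def scrD (p : Momentum) : ℂ := 16 * ∑ k, ∏ j ∈ Finset.univ.erase k, invSqBracket j p

/-- «l₁ = ⟨1/p₂²⟩⟨1/p₃²⟩ + ⟨1/p₂²⟩⟨1/p₄²⟩ + ⟨1/p₃²⟩⟨1/p₄²⟩, (2.2) l_i = −∏_{j≠1,i} ⟨1/p_j²⟩, i ≠ 1. (2.3)» (print's `1` = `0`).
[cite: FederbushWilliamson1987PhaseCellII, (2.2)–(2.3) p. 1417] -/
def l (i : Fin 4) (p : Momentum) : ℂ :=
  if i = 0 then
    invSqBracket 1 p * invSqBracket 2 p + invSqBracket 1 p * invSqBracket 3 p + invSqBracket 2 p * invSqBracket 3 p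
  else -∏ j ∈ (Finset.univ.erase 0).erase i, invSqBracket j p

/-- «A′_i = (−r_L f̄₁⁻¹ (1/p²)) (1/p_i) (16/𝒟) l_i, (2.1)» — the Landau-gauge mode of I (3.12) for the single unit bond in the
+1 direction at the origin. [cite: FederbushWilliamson1987PhaseCellII, (2.1) p. 1417; Federbush1986PhaseCellI, (3.12) p. 328] -/
def Aprime (i : Fin 4) (p : Momentum) : ℂ :=
  (-rL p * (fbar p 0)⁻¹ * (1 / csq p)) * (1 / p i) * (16 / scrD p) * l i p

/-- «X(p) = (−r_L f̄₁⁻¹ (1/(p²)²)) (1/⟨1/p₁²⟩) (1/(1 + p²)^s), (2.5) where s is an arbitrary integer, sufficiently large.»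
[cite: FederbushWilliamson1987PhaseCellII, (2.5) p. 1417] -/
def X (s : ℕ) (p : Momentum) : ℂ :=
  (-rL p * (fbar p 0)⁻¹ * (1 / csq p ^ 2)) * (1 / invSqBracket 0 p) * (1 / (1 + csq p) ^ s)

/-- «We define A^N_i(p), a gauge transformation of A′_i(p), by A^N_i(p) = A′_i(p) + p_iX(p), (2.4)».
[cite: FederbushWilliamson1987PhaseCellII, (2.4) p. 1417; Federbush1986PhaseCellI, p. 328] -/
def AN (s : ℕ) (i : Fin 4) (p : Momentum) : ℂ := Aprime i p + p i * X s p

/-- The real generic momenta `p ∈ (−π, π]⁴`, all `p_j ≠ 0`, at which every denominator of (2.1)–(2.5) is non-zero (the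
formula's native domain, §I–§II). [cite: FederbushWilliamson1987PhaseCellII, §I–§II p. 1416–1417] -/
def realGeneric : Set Momentum :=
  {p | ∀ j, (p j).im = 0 ∧ p j ≠ 0 ∧ -Real.pi < (p j).re ∧ (p j).re ≤ Real.pi}

/-- «the domain, 𝒟_L, specified by −π ≤ Re p_j ≤ π, |Im p_j| < ε₀, (3.2)». [cite: FederbushWilliamson1987PhaseCellII, (3.2)
p. 1417] -/
def DL (ε₀ : ℝ) : Set Momentum := {p | ∀ j, -Real.pi ≤ (p j).re ∧ (p j).re ≤ Real.pi ∧ |(p j).im| < ε₀}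

/-- «the domain, 𝒟_G, specified by |Im p_j| < ε₀. (3.3)». [cite: FederbushWilliamson1987PhaseCellII, (3.3) p. 1417] -/
def DG (ε₀ : ℝ) : Set Momentum := {p | ∀ j, |(p j).im| < ε₀}

/-- «the domain, 𝒟_B, specified by |Im p_j| < ε₀/2, (3.4)». [cite: FederbushWilliamson1987PhaseCellII, (3.4) p. 1417] -/
def DB (ε₀ : ℝ) : Set Momentum := {p | ∀ j, |(p j).im| < ε₀ / 2}

/-- **Theorem 3.1 (Local analyticity)** «There is an ε₀ > 0 such that in the domain, 𝒟_L, specified by −π ≤ Re p_j ≤ π,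
|Im p_j| < ε₀, (3.2) A^N_i(p) is analytic.» (proof: §V–§VI).  TYPED: an extension analytic at every point of `𝒟_L` agreeing
with the formula (2.4) on the real generic momenta. [cite: FederbushWilliamson1987PhaseCellII, Theorem 3.1 (3.2) p. 1417] -/
def Theorem31 (s : ℕ) (i : Fin 4) : Prop :=
  ∃ ε₀ > (0 : ℝ), ∃ g : Momentum → ℂ, AnalyticOnNhd ℂ g (DL ε₀) ∧ ∀ p ∈ realGeneric, g p = AN s i p

/-- **Theorem 3.2 (Global analyticity)** «A^N_i(p) is analytic in the domain, 𝒟_G, specified by |Im p_j| < ε₀. (3.3)» («the ε₀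
is as defined in Theorem 3.1»; «easy consequences of the form of A^N_i(p) and Theorem 3.1» via the periodicity (3.1)).
[cite: FederbushWilliamson1987PhaseCellII, Theorem 3.2 (3.3) p. 1417] -/
def Theorem32 (s : ℕ) (i : Fin 4) : Prop :=
  ∃ ε₀ > (0 : ℝ), ∃ g : Momentum → ℂ, AnalyticOnNhd ℂ g (DG ε₀) ∧ ∀ p ∈ realGeneric, g p = AN s i p

/-- **Theorem 3.3 (Boundedness)** «Within the domain, 𝒟_B, specified by |Im p_j| < ε₀/2, (3.4) A^N_i(p) satisfies bounds of the
form |A^N_i(p)| < c ∏_j (1/(|p_j| + 1)) (1/(|p²| + 1)). (3.5)» (for the analytic extension of Theorems 3.1–3.2).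
[cite: FederbushWilliamson1987PhaseCellII, Theorem 3.3 (3.4)–(3.5) p. 1417] -/
def Theorem33 (s : ℕ) (i : Fin 4) : Prop :=
  ∃ ε₀ > (0 : ℝ), ∃ g : Momentum → ℂ, AnalyticOnNhd ℂ g (DG ε₀) ∧ (∀ p ∈ realGeneric, g p = AN s i p) ∧
    ∃ c : ℝ, ∀ p ∈ DB ε₀, ‖g p‖ < c * (∏ j, 1 / (‖p j‖ + 1)) * (1 / (‖csq p‖ + 1))

/-- The three theorems as asserted, with «s … an arbitrary integer, sufficiently large» (p. 1417, after (2.5)) as the outer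
quantifier and a COMMON `ε₀` («In Theorems 3.2 and 3.3 the ε₀ is as defined in Theorem 3.1»), for each component `i`.
[cite: FederbushWilliamson1987PhaseCellII, Theorems 3.1–3.3 p. 1417] -/
def Theorems31to33 : Prop :=
  ∃ s₀ : ℕ, ∀ s, s₀ ≤ s → ∀ i : Fin 4, ∃ ε₀ > (0 : ℝ), ∃ g : Momentum → ℂ,
    AnalyticOnNhd ℂ g (DL ε₀) ∧ AnalyticOnNhd ℂ g (DG ε₀) ∧ (∀ p ∈ realGeneric, g p = AN s i p) ∧
      ∃ c : ℝ, ∀ p ∈ DB ε₀, ‖g p‖ < c * (∏ j, 1 / (‖p j‖ + 1)) * (1 / (‖csq p‖ + 1))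

/-- `𝒟_L ⊆ 𝒟_G`: Theorem 3.2's domain contains Theorem 3.1's (bookkeeping, proved). [cite: FederbushWilliamson1987PhaseCellII,
(3.2)–(3.3) p. 1417] -/
theorem DL_subset_DG (ε₀ : ℝ) : DL ε₀ ⊆ DG ε₀ := fun _ hp j => (hp j).2.2

/-- `𝒟_B ⊆ 𝒟_G` for `ε₀ ≥ 0` (bookkeeping, proved). [cite: FederbushWilliamson1987PhaseCellII, (3.3)–(3.4) p. 1417] -/
theorem DB_subset_DG {ε₀ : ℝ} (h : 0 ≤ ε₀) : DB ε₀ ⊆ DG ε₀ := fun _ hp j => lt_of_lt_of_le (hp j) (by linarith)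

/-- Hence the packaged statement yields each of Theorems 3.1, 3.2, 3.3 for all large `s` (bookkeeping, proved).
[cite: FederbushWilliamson1987PhaseCellII, Theorems 3.1–3.3 p. 1417] -/
theorem theorems_of_Theorems31to33 (h : Theorems31to33) :
    ∃ s₀ : ℕ, ∀ s, s₀ ≤ s → ∀ i : Fin 4, Theorem31 s i ∧ Theorem32 s i ∧ Theorem33 s i := by
  obtain ⟨s₀, hs⟩ := h
  refine ⟨s₀, fun s hs' i => ?_⟩
  obtain ⟨ε₀, hε₀, g, hL, hG, hagree, c, hc⟩ := hs s hs' i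
  exact ⟨⟨ε₀, hε₀, g, hL, hagree⟩, ⟨ε₀, hε₀, g, hG, hagree⟩, ⟨ε₀, hε₀, g, hG, hagree, c, hc⟩⟩

end ModeAnalyticity

end

end Literature.MathematicalPhysics.QuantumFieldTheory.Federbush1986
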